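import Summits.BirchSwinnertonDyer.BirchSwinnertonDyer.Theorems.ManinLocalTwoThreeRigidityImpliesTower
import Summits.BirchSwinnertonDyer.Rank1Residual.ManinAdditive.KatoCurvePlusDefectLevers
import Literature.NumberTheory.EllipticCurves.KatoAdditiveTwistedValueNeronIntegralityThreeKPForms
import HarnessLib

/-!
# C3 / C2 ⟸ KATO'S FACT AT `W` ∧ PLUS INDEX PRIME TO `p` — at EVERY `9 ∣ N` / `4 ∣ N`, with NO cell law (LEAD status theorem, p1 gen 11)
# (route `ManinLocalTwoThree`, cell bsd-f2-manin; cruxes C3 `ManinPrimeToThreeAtNine` stmt-22968 / C2 `ManinOddAtFour` stmt-22967)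

After p2 g11's UNCONDITIONAL tower theorems E-es-66 `threeAdicWitnessOfPlusIndexPrimeToThree_holds` and E-es-66₂
`twoAdicWitnessOfPlusIndexOdd_holds` (`…RigidityImpliesTower.lean`, p679277) the shortest road to the two cruxes reads, for a lattice-optimal
globally minimal `W` with newform `D.f`:
* **`not_three_dvd_maninConstant_of_katoFactThreeAt_of_plusIndexPrimeTo`**: `9 ∣ N`, `KatoFactThreeAt W D.f` (Kato's `p = 3` fact AT `W`:
  the Literature fact F₃ `…_three_polar` / F₃♮ `…_three_kp` when `W[3]` is irreducible — `katoFactThreeAt_of_polar`, `katoFactThreeAt_of_kp` —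
  and the content of the symbol-closure fact on the reducible locus) and `PlusIndexPrimeTo 3 D.f` ⟹ `3 ∤ c`;
* **`not_two_dvd_maninConstant_of_katoFactTwoAt_of_plusIndexPrimeTo`**: `4 ∣ N`, `KatoFactTwoAt W D.f` (= F♯ when `W[2]` is irreducible,
  `katoFactTwoAt_of_real`) and `PlusIndexPrimeTo 2 D.f` ⟹ `2 ∤ c`;
* the F₃ / F₃♮ / F♯ instances on the irreducible loci (`…_of_polar_of_irreducible`, `…_of_kp_of_irreducible`, `…_of_real_of_irreducible`).
So, BY NAME: **C3 ⟸ Kato at `W` ∧ `PlusIndexPrimeTo 3`** and **C2 ⟸ Kato at `W` ∧ `PlusIndexPrimeTo 2`** class by class; the OPEN content of the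
cruxes on this road is exactly (a) Kato's printed fact (and its reducible-locus form), (b) the plus index: `3 ∣ [Λ_f⁺ : Λ₁(f)⁺]` only with a
rational `3`-torsion point or on the `μ₃`-residual E-es-67♯ (`plusIndexPrimeTo_three_of_no_shortThreeTorsion_of_not_hasShortMuThree`);
`2 ∣` the plus index only on 24 `W[2]`-reducible classes `< 10⁴` (es E42c).  Pure compositions of tree theorems (the lever
`not_{three,two}_dvd_of_katoFact{Three,Two}At_of_witness`, es g16/g14); CONDITIONAL on the displayed Kato hypothesis; C2, C3, Manin's
conjecture and BSD are NOT proved.  No definitions, no sorry.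
[cite: Kato2004Asterisque, Thm. 12.5 and Thm. 6.6 (1) (shape; the named facts are statement-only)]
-/

set_option autoImplicit false
set_option linter.dupNamespace false

noncomputable section

open scoped Classical MatrixGroups ModularForm ComplexConjugate

open CongruenceSubgroup Complex WeierstrassCurve Literature.NumberTheory.EllipticCurves
  Literature.NumberTheory.EllipticCurves.ModularForms
  Summit.BirchSwinnertonDyer.Rank1Residual.ManinAdditive.KatoCurve

namespace Summit.BirchSwinnertonDyer.BirchSwinnertonDyer.Theorems.ManinLocalTwoThree

variable (W : WeierstrassCurve ℚ) [W.IsElliptic] [W.IsGloballyMinimal] {N : ℕ} [NeZero N]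

/-- **C3 class by class ⟸ Kato's fact at `W` ∧ plus index prime to `3`** (every `9 ∣ N`; E-es-66 is a theorem, so no cell law enters):
lattice-optimal `W`, `KatoFactThreeAt W D.f`, `PlusIndexPrimeTo 3 D.f` ⟹ `3 ∤ c`. [cite: Kato2004Asterisque, Thm. 6.6 (1) (p. 163) (shape)] -/
theorem not_three_dvd_maninConstant_of_katoFactThreeAt_of_plusIndexPrimeTo (D : ModularParametrizationData W N)
    (hF : KatoFactThreeAt W D.f) (hopt : ∀ z ∈ D.L.lattice, ∃ w ∈ periodLattice D.f, z = D.c * w) (h9 : 3 ^ 2 ∣ N)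
    (hd : PlusIndexPrimeTo 3 D.f) : ¬ (3 : ℤ) ∣ D.c := by
  have hwit : ThreeAdicPolarWitness W W D.f := threeAdicWitnessOfPlusIndexPrimeToThree_holds W D hopt h9 hd
  have hΩ : W.realPeriodRat = ((|D.c| : ℤ) : ℝ) * plusPeriod D.f := by
    rw [Int.cast_abs]; exact D.realPeriodRat_eq_abs_mul_plusPeriod_of_latticeEq hopt
  have h := not_three_dvd_of_katoFactThreeAt_of_witness W W D.f |D.c| hF hwit hΩ
    (abs_ne_zero.mpr D.maninConstant_ne_zero_holds)
  exact fun h3 ↦ h ((dvd_abs 3 D.c).mpr h3)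

/-- **C2 class by class ⟸ Kato's fact at `W` ∧ plus index odd** (every `4 ∣ N`; E-es-66₂ is a theorem): lattice-optimal `W`,
`KatoFactTwoAt W D.f`, `PlusIndexPrimeTo 2 D.f` ⟹ `2 ∤ c`. [cite: Kato2004Asterisque, Thm. 12.5 (1) (p. 221) (shape)] -/
theorem not_two_dvd_maninConstant_of_katoFactTwoAt_of_plusIndexPrimeTo (D : ModularParametrizationData W N)
    (hF : KatoFactTwoAt W D.f) (hopt : ∀ z ∈ D.L.lattice, ∃ w ∈ periodLattice D.f, z = D.c * w) (h4 : 2 ^ 2 ∣ N)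
    (hd : PlusIndexPrimeTo 2 D.f) : ¬ (2 : ℤ) ∣ D.c := by
  have hwit : TwoAdicPolarWitness W W D.f := twoAdicWitnessOfPlusIndexOdd_holds W D hopt h4 hd
  have hΩ : W.realPeriodRat = ((|D.c| : ℤ) : ℝ) * plusPeriod D.f := by
    rw [Int.cast_abs]; exact D.realPeriodRat_eq_abs_mul_plusPeriod_of_latticeEq hopt
  have h := not_two_dvd_of_katoFactTwoAt_of_witness W W D.f |D.c| hF hwit hΩ
    (abs_ne_zero.mpr D.maninConstant_ne_zero_holds)
  exact fun h2 ↦ h ((dvd_abs 2 D.c).mpr h2)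

/-- **C3 on the `W[3]`-irreducible locus with plus index prime to `3` ⟸ the Literature fact F₃ (polar form) alone.**
[cite: Kato2004Asterisque, Thm. 6.6 (1) (p. 163) (shape)] -/
theorem not_three_dvd_maninConstant_of_polar_of_irreducible_of_plusIndexPrimeTo
    (hK : kato_neron_isIntegral_twistedSymbolSum_of_additive_three_polar) (D : ModularParametrizationData W N)
    (hirr : W.HasIrreducibleModPGaloisRep 3) (hopt : ∀ z ∈ D.L.lattice, ∃ w ∈ periodLattice D.f, z = D.c * w)
    (h9 : 3 ^ 2 ∣ N) (hd : PlusIndexPrimeTo 3 D.f) : ¬ (3 : ℤ) ∣ D.c :=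
  not_three_dvd_maninConstant_of_katoFactThreeAt_of_plusIndexPrimeTo W D (katoFactThreeAt_of_polar hK W D.f hirr) hopt h9 hd

/-- **The same from the Kosters–Pannekoek form F₃♮ (the C3 skeleton's stub 1).** [cite: Kato2004Asterisque, Thm. 6.6 (1) (p. 163) (shape)] -/
theorem not_three_dvd_maninConstant_of_kp_of_irreducible_of_plusIndexPrimeTo
    (hK : kato_neron_isIntegral_twistedSymbolSum_of_additive_three_kp) (D : ModularParametrizationData W N)
    (hirr : W.HasIrreducibleModPGaloisRep 3) (hopt : ∀ z ∈ D.L.lattice, ∃ w ∈ periodLattice D.f, z = D.c * w)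
    (h9 : 3 ^ 2 ∣ N) (hd : PlusIndexPrimeTo 3 D.f) : ¬ (3 : ℤ) ∣ D.c :=
  not_three_dvd_maninConstant_of_katoFactThreeAt_of_plusIndexPrimeTo W D
    (katoFactThreeAt_of_kp W D.f (katoFactThreeAtKP_of_kp hK W D.f hirr)) hopt h9 hd

/-- **C2 on the `W[2]`-irreducible locus with odd plus index ⟸ the Literature fact F♯ alone.**
[cite: Kato2004Asterisque, Thm. 12.5 (1) (p. 221) (shape)] -/
theorem not_two_dvd_maninConstant_of_real_of_irreducible_of_plusIndexPrimeTo
    (hK : kato_neron_isIntegral_twistedSymbolSum_of_additive_two_real) (D : ModularParametrizationData W N)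
    (hirr : W.HasIrreducibleModPGaloisRep 2) (hopt : ∀ z ∈ D.L.lattice, ∃ w ∈ periodLattice D.f, z = D.c * w)
    (h4 : 2 ^ 2 ∣ N) (hd : PlusIndexPrimeTo 2 D.f) : ¬ (2 : ℤ) ∣ D.c :=
  not_two_dvd_maninConstant_of_katoFactTwoAt_of_plusIndexPrimeTo W D (katoFactTwoAt_of_real hK W D.f hirr) hopt h4 hd

end Summit.BirchSwinnertonDyer.BirchSwinnertonDyer.Theorems.ManinLocalTwoThree

end
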